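import Summits.BirchSwinnertonDyer.BirchSwinnertonDyer.Theorems.PrintCf2RamifiedOffTYZPartnerShaSelmerCount
import HarnessLib

/-!
# WORKFILE (crux stmt-BirchSwinnertonDyer-20509, line `offtyz-v7`, LEAD cruxlead-20509 g23, cycle 24) — THE ODD TWO-PRIME SECTORS R1/R2 OF
# C⁺ AFTER «PartnerSha»: the two PARTNER LAWS (F1) and the two ENTRY LAWS (Selmer side + analytic side) as typed CONJECTURES, with the
# proved compositions «partner law ⟹ the #Sel₄ hypothesis of C⁺ is a theorem on the no-half» and «jump law ∧ genus formula ⟹ C⁺ on the sector»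

Status: CONJECTURES typed for cruxplan-23431 / the disprover / the next lead; `def … : Prop` only because this is a crux WORKFILE
(`Cruxes/RamifiedOffTYZOfFacts/Lines/`), never a Theorems/Literature proposal.  Nothing here is asserted.  The THEOREMS it composes with are in the
tree: cycle 21 (g20) `…PartnerSha{Rigidity,SelmerR2,SelmerR2Prime,LevelTwoR2}` and cycle 24 (g23) `…PartnerSha{SelmerR1,SelmerR1Local,SelmerR1Prime,LevelTwoR1,SelmerCount}`
(HEADLINE «`Ш(A_n)[2] = 0 ⟺ ρ(n) ≠ 0 ∧ #Sel₄(E_n) = 2⁶`» on BOTH odd two-prime sectors of category D).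

Sectors (category D, two odd primes, `s(n) = 3`): R1: `n = lm`, `l ≡ 1 (8)`, `m ≡ 5 (8)`, `(l/m) = (m/l) = 1` (`n ≡ 5 (8)`); R2: `n = lq`, `l ≡ 1 (8)`,
`q ≡ 7 (8)`, `(l/q) = (q/l) = 1` (`n ≡ 7 (8)`, block-free).  Census of record (0 exceptions each): cruxlead g15 `Lines/offtyz_v7_SpecialStratum.md` §1–§3
(1434 G members n ≤ 10⁵: `dim Sel₂(A_n/ℚ) ∈ {2,4}`; (ρ-R1) `ρ = 1 ⟺ (l/m)₄(m/l)₄ = −1`, 798/798; (ρ-R2) `ρ = 1 ⟺ l ≠ x² + 32y²`, 636/636), planner g6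
HOME `bsd-print-cf2-plan/Ideas/census-1e5/ANALYSIS.md` ((R1) B ⟺ `(l/m)₄ = (m/l)₄ = +1 ∧ l = x² + 32y²`, 876/876; (R2) B ⟺ `(q/l)₄ = +1 ∧ l = x² + 32y² ∧
8 ∣ #Cl(ℚ(√(lq)))[2^∞]`, 692/692 — the referee's falsifier F2 («are the R2 mixed classes separated by a Rédei-type symbol?») is answered THERE: the third
R2 entry is the 8-rank bit of the REAL quadratic field, a Rédei symbol), cruxlead g17 `census_full_table.md` (R2, 122 rows).

PAPER PATH for the partner laws (support-grade, in the range of print): Ouyang–Zhang, Acta Arith. 170 (2015) [held: paper:doi-10-4064-aa170-4-3] treat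
EXACTLY the pair `E = E_{0,−n²} = E_n`, `E′ = E_{0,4n²} = A_n` (their §2.2); on G, `Ш(A_n)[2] = 0 ⟺ S̃^{(φ)}(E_n) = {1}` (image of `Sel₂(A_n)` in
`Sel^{(φ)}(E_n)`, their (2.2)); their Lemma 2.3 (second-descent curves `M_s`) needs a rational point of the conic `dσ² = d²τ² + 4n²μ²`, which §2.4
supplies from `d = τ² − b₁μ²` with `b₁ = −1` — i.e. from `d = τ² + μ²`, AVAILABLE IN CLOSED FORM on our sectors (`d ∈ {l, m, lm}` resp. `{2, l, 2l}`,
sums of two squares: `l = τ² + μ² ↔ π_l = τ + μi`); their Prop. 2.8 then gives the local conditions of `M_s` in the Gaussian symbols `((τ ± μi)/p)`, and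
Burde's rational quartic reciprocity turns these into `(l/m)₄(m/l)₄` (R1) resp. `((1+i)/π_l)₂ = (2/l)₄(l/2)₄` (R2).  Kernel: needs OZ15 Lemma 2.3 /
Prop. 2.8 typed (Literature) and the bridge «`selmerGroup 2` of the partner → `twoIsogenySelmerGroup'`» (the tree has `twoIsogenyTorsorHom`, `xSqClass`
for `E(ℚ)`, not yet for `Sel₂(A_n)`).  BSD is not proved by any of this; no class is closed by this file.
-/

noncomputable section

open scoped Classical

open WeierstrassCurve Literature.NumberTheory.EllipticCurves Literature.NumberTheory.EllipticCurves.Rank1Residual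
  Literature.NumberTheory.EllipticCurves.TianYuanZhang2017 NumberField
  Summit.BirchSwinnertonDyer.PrintCf2.PartnerSha

set_option autoImplicit false

namespace Summit.BirchSwinnertonDyer.PrintCf2.LevelTwo.OddSectors

/-! ## §1 The symbols -/

/-- «`(l/m)₄ · (m/l)₄ = −1`» for primes `l ≡ m ≡ 1 (mod 4)` with `(l/m) = 1`: exactly one of `l mod m`, `m mod l` is a fourth power (by Scholz's
reciprocity this is `(ε_l/m) = −1`; by genus theory `h(ℚ(√(lm))) ≡ 2 (mod 4)`). -/
def ScholzMinus (l m : ℕ) : Prop :=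
  Xor (∃ x : ZMod m, x ^ 4 = (l : ZMod m)) (∃ x : ZMod l, x ^ 4 = (m : ZMod l))

/-- «`l = x² + 32y²`» for a prime `l ≡ 1 (mod 8)` (Barrucand–Cohn: ⟺ `8 ∣ h(−4l)` ⟺ `(2/l)₄(l/2)₄ = +1` ⟺ `((1+i)/π_l)₂ = +1`). -/
def SumSq32 (l : ℕ) : Prop :=
  ∃ a b : ℤ, (l : ℤ) = a ^ 2 + 32 * b ^ 2

/-- «`Cl(ℚ(√(lq)))` has an element of order `8`» (the REAL quadratic field; on R2 its `2`-part is cyclic, so this is `8 ∣ #Cl[2^∞]`), stated over every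
model `K` of `ℚ(√(lq))` (`[K:ℚ] = 2`, `lq` a square in `K`). -/
def RealClassOrderEight (l q : ℕ) : Prop :=
  ∀ (K : Type) [Field K] [NumberField K], Module.finrank ℚ K = 2 → (∃ x : K, x ^ 2 = ((l * q : ℕ) : K)) →
    ∃ c : ClassGroup (𝓞 K), orderOf c = 8

/-- The planner-g6 census predicate on R2: `B ⟺ (q/l)₄ = +1 ∧ l = x² + 32y² ∧ 8 ∣ #Cl(ℚ(√(lq)))[2^∞]` (692/692, 0 exceptions). -/
def R2Deep (l q : ℕ) : Prop :=
  (∃ x : ZMod l, x ^ 4 = (q : ZMod l)) ∧ SumSq32 l ∧ RealClassOrderEight l q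

/-! ## §2 The partner laws (F1): one typed 2-descent statement per sector — CONJECTURES (support-grade; OZ15-type second descent) -/

/-- **CONJECTURE F1-R1 (partner law on R1)** — census (ρ-R1) 798/798 read through the HEADLINE `partner_sha_two_eq_bot_iff_R1` and K1″:
on R1 with `ord_{s=1} L(E_{lm},s) = 1` and `#Sel₂(E_{lm}) = 2⁵`: **`Ш(A_{lm})[2] = 0 ⟺ (l/m)₄(m/l)₄ = −1`** (i.e. `dim Sel₂(A_{lm}/ℚ) = 2` iff the Scholz
symbol is `−1`).  A full `2`-descent of `A_{lm}` over `ℚ` (Shapiro: `H¹(ℚ, A[2]) = ℚ(i)^×/□`) / OZ15 second descent; not kernel-provable today. -/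
def PartnerLawR1 : Prop :=
  ∀ (l m : ℕ) [Fact l.Prime] [Fact m.Prime] [(congruentNumberCurve (l * m)).IsElliptic],
    l % 8 = 1 → m % 8 = 5 → IsSquare ((l : ℤ) : ZMod m) → IsSquare ((m : ℤ) : ZMod l) →
    (congruentNumberCurve (l * m)).analyticRank = 1 →
    Nat.card ((congruentNumberCurve (l * m)).selmerGroup 2) = 2 ^ 5 →
    ((∀ c ∈ (congruentNumberCurve (l * m)).twoIsogenyCodomain.sha, 2 • c = 0 → c = 0) ↔ ScholzMinus l m)

/-- **CONJECTURE F1-R2 (partner law on R2)** — census (ρ-R2) 636/636 + g17's 122-row table read through `partner_sha_two_eq_bot_iff_R2`: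
on R2 with `ord_{s=1} L(E_{lq},s) = 1` and `#Sel₂(E_{lq}) = 2⁵`: **`Ш(A_{lq})[2] = 0 ⟺ l ≠ x² + 32y²`** (`⟺ ((1+i)/π_l)₂ = −1`). -/
def PartnerLawR2 : Prop :=
  ∀ (l q : ℕ) [Fact l.Prime] [Fact q.Prime] [(congruentNumberCurve (l * q)).IsElliptic],
    l % 8 = 1 → q % 8 = 7 → IsSquare ((l : ℤ) : ZMod q) → IsSquare ((q : ℤ) : ZMod l) →
    (congruentNumberCurve (l * q)).analyticRank = 1 →
    Nat.card ((congruentNumberCurve (l * q)).selmerGroup 2) = 2 ^ 5 →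
    ((∀ c ∈ (congruentNumberCurve (l * q)).twoIsogenyCodomain.sha, 2 • c = 0 → c = 0) ↔ ¬ SumSq32 l)


/-! ## §2bis The partner laws in `2`-Selmer currency (what a descent engine / OZ15-type facts deliver) and their equivalence with §2 -/

/-- **F1-R1, Selmer currency**: on R1 with `ord_{s=1} L(E_{lm},s) = 1`, `#Sel₂(E_{lm}) = 2⁵`: `#Sel₂(A_{lm}/ℚ) = 4 ⟺ (l/m)₄(m/l)₄ = −1`
(cruxlead g15's census column «`dim Sel₂(A_n/ℚ)`», 798/798 on G). CONJECTURE. -/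
def PartnerLawR1' : Prop :=
  ∀ (l m : ℕ) [Fact l.Prime] [Fact m.Prime] [(congruentNumberCurve (l * m)).IsElliptic],
    l % 8 = 1 → m % 8 = 5 → IsSquare ((l : ℤ) : ZMod m) → IsSquare ((m : ℤ) : ZMod l) →
    (congruentNumberCurve (l * m)).analyticRank = 1 →
    Nat.card ((congruentNumberCurve (l * m)).selmerGroup 2) = 2 ^ 5 →
    (Nat.card ((congruentNumberCurve (l * m)).twoIsogenyCodomain.selmerGroup 2) = 4 ↔ ScholzMinus l m)

/-- **F1-R2, Selmer currency**: on R2 with `ord_{s=1} L(E_{lq},s) = 1`, `#Sel₂(E_{lq}) = 2⁵`: `#Sel₂(A_{lq}/ℚ) = 4 ⟺ l ≠ x² + 32y²` (636/636 on G).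
CONJECTURE. -/
def PartnerLawR2' : Prop :=
  ∀ (l q : ℕ) [Fact l.Prime] [Fact q.Prime] [(congruentNumberCurve (l * q)).IsElliptic],
    l % 8 = 1 → q % 8 = 7 → IsSquare ((l : ℤ) : ZMod q) → IsSquare ((q : ℤ) : ZMod l) →
    (congruentNumberCurve (l * q)).analyticRank = 1 →
    Nat.card ((congruentNumberCurve (l * q)).selmerGroup 2) = 2 ^ 5 →
    (Nat.card ((congruentNumberCurve (l * q)).twoIsogenyCodomain.selmerGroup 2) = 4 ↔ ¬ SumSq32 l)

/-- **The two currencies agree (granted GZK for the rank): `PartnerLawR1 ⟺ PartnerLawR1'`** — by the kernel dictionary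
`partner_sha_two_trivial_iff_natCard_selmerTwo` (cycle 24 part 5). -/
theorem partnerLawR1_iff (hGZK : rank_eq_analyticRank_of_analyticRank_le_one) : PartnerLawR1 ↔ PartnerLawR1' := by
  constructor
  · intro h l m _ _ _ hl8 hm8 hlm hml hr1 h₂
    have hlm_ne : l ≠ m := by rintro rfl; omega
    obtain ⟨hsq, -⟩ := squarefree_and_one_lt_R2 (l := l) (q := m) hlm_ne
    have hrank : (congruentNumberCurve (l * m)).mordellWeilRank = 1 := (hGZK _ hr1.le).1.trans hr1
    rw [← partner_sha_two_trivial_iff_natCard_selmerTwo hsq hrank]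
    exact h l m hl8 hm8 hlm hml hr1 h₂
  · intro h l m _ _ _ hl8 hm8 hlm hml hr1 h₂
    have hlm_ne : l ≠ m := by rintro rfl; omega
    obtain ⟨hsq, -⟩ := squarefree_and_one_lt_R2 (l := l) (q := m) hlm_ne
    have hrank : (congruentNumberCurve (l * m)).mordellWeilRank = 1 := (hGZK _ hr1.le).1.trans hr1
    rw [partner_sha_two_trivial_iff_natCard_selmerTwo hsq hrank]
    exact h l m hl8 hm8 hlm hml hr1 h₂

/-- **`PartnerLawR2 ⟺ PartnerLawR2'`** (granted GZK for the rank). -/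
theorem partnerLawR2_iff (hGZK : rank_eq_analyticRank_of_analyticRank_le_one) : PartnerLawR2 ↔ PartnerLawR2' := by
  constructor
  · intro h l q _ _ _ hl8 hq8 hlq hql hr1 h₂
    have hlq_ne : l ≠ q := by rintro rfl; omega
    obtain ⟨hsq, -⟩ := squarefree_and_one_lt_R2 (l := l) (q := q) hlq_ne
    have hrank : (congruentNumberCurve (l * q)).mordellWeilRank = 1 := (hGZK _ hr1.le).1.trans hr1
    rw [← partner_sha_two_trivial_iff_natCard_selmerTwo hsq hrank]
    exact h l q hl8 hq8 hlq hql hr1 h₂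
  · intro h l q _ _ _ hl8 hq8 hlq hql hr1 h₂
    have hlq_ne : l ≠ q := by rintro rfl; omega
    obtain ⟨hsq, -⟩ := squarefree_and_one_lt_R2 (l := l) (q := q) hlq_ne
    have hrank : (congruentNumberCurve (l * q)).mordellWeilRank = 1 := (hGZK _ hr1.le).1.trans hr1
    rw [partner_sha_two_trivial_iff_natCard_selmerTwo hsq hrank]
    exact h l q hl8 hq8 hlq hql hr1 h₂

/-! ## §3 The entry laws on R2 (Selmer side: planner g6 census law; analytic side: C⁺|R2 in genus currency) — CONJECTURES -/

/-- **CONJECTURE K-R2-CT (the Cassels–Tate jump law on R2)** — planner g6 (R2), 692/692: on R2 with `#Sel₂(E_{lq}) = 2⁵`,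
`#Sel₄(E_{lq}) = 2⁶ ⟺ ¬ R2Deep l q`.  Support-grade (a `4`-descent / Rédei-matrix statement; the third bit is the `8`-rank of the REAL field). -/
def LevelTwoJumpLawR2 : Prop :=
  ∀ (l q : ℕ) [Fact l.Prime] [Fact q.Prime] [(congruentNumberCurve (l * q)).IsElliptic],
    l % 8 = 1 → q % 8 = 7 → IsSquare ((l : ℤ) : ZMod q) → IsSquare ((q : ℤ) : ZMod l) →
    Nat.card ((congruentNumberCurve (l * q)).selmerGroup 2) = 2 ^ 5 →
    (Nat.card ((congruentNumberCurve (l * q)).selmerGroup 4) = 2 ^ 6 ↔ ¬ R2Deep l q)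

/-- **CONJECTURE K-R2-𝓛 (the level-two genus FORMULA on R2 ∩ {r_an = 1})**: `2 ∥ 𝓛(lq) ⟺ ¬ R2Deep l q` (and `4 ∣ 𝓛(lq)` on the deep members).
Beyond print — it is C⁺ restricted to R2 together with its B-side complement (g17 census: 117 × `v₂(𝓛) = 1` on G, 5 × `v₂ = 2` on B, n ≤ 2·10⁴). -/
def LevelTwoGenusFormulaR2 : Prop :=
  ∀ (l q : ℕ) [Fact l.Prime] [Fact q.Prime] [(congruentNumberCurve (l * q)).IsElliptic],
    l % 8 = 1 → q % 8 = 7 → IsSquare ((l : ℤ) : ZMod q) → IsSquare ((q : ℤ) : ZMod l) →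
    (congruentNumberCurve (l * q)).analyticRank = 1 →
    Nat.card ((congruentNumberCurve (l * q)).selmerGroup 2) = 2 ^ 5 →
    ∀ L : ℤ, IsScriptL (l * q) L → (((2 : ℤ) ∣ L ∧ ¬ (4 : ℤ) ∣ L) ↔ ¬ R2Deep l q)

/-! ## §4 Proved compositions (real proofs over the tree's theorems; the conjectures enter as hypotheses) -/

section Compositions

variable {l m q : ℕ} [hlp : Fact l.Prime] [hmp : Fact m.Prime] [hqp : Fact q.Prime]

/-- **Granted F1-R1, the `#Sel₄ = 2⁶` hypothesis of item 23431 is a THEOREM on the Scholz-minus half of R1** (with GZK): `(l/m)₄(m/l)₄ = −1`,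
`ord_{s=1} L(E_{lm},s) = 1`, `#Sel₂ = 2⁵ ⟹ #Sel₄(E_{lm}) = 2⁶` — by F1-R1 and the kernel theorem `selmerFour_of_partner_R1_of_facts` (T1 on R1). -/
theorem selmerFour_onR1_of_partnerLaw (hP : PartnerLawR1) (hGZK : rank_eq_analyticRank_of_analyticRank_le_one)
    (hl8 : l % 8 = 1) (hm8 : m % 8 = 5) (hlm : IsSquare ((l : ℤ) : ZMod m)) (hml : IsSquare ((m : ℤ) : ZMod l))
    (hS : ScholzMinus l m)
    (hr1 : haveI := isElliptic_congruentNumberCurve (Nat.mul_ne_zero hlp.out.ne_zero hmp.out.ne_zero);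
      (congruentNumberCurve (l * m)).analyticRank = 1)
    (h₂ : haveI := isElliptic_congruentNumberCurve (Nat.mul_ne_zero hlp.out.ne_zero hmp.out.ne_zero);
      Nat.card ((congruentNumberCurve (l * m)).selmerGroup 2) = 2 ^ 5) :
    haveI := isElliptic_congruentNumberCurve (Nat.mul_ne_zero hlp.out.ne_zero hmp.out.ne_zero)
    Nat.card ((congruentNumberCurve (l * m)).selmerGroup 4) = 2 ^ 6 := by
  haveI := isElliptic_congruentNumberCurve (Nat.mul_ne_zero hlp.out.ne_zero hmp.out.ne_zero)
  have hA := (hP l m hl8 hm8 hlm hml hr1 h₂).mpr hS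
  exact selmerFour_of_partner_R1_of_facts hGZK hl8 hm8 hlm hml hr1 h₂ hA

/-- **Granted F1-R1 and the three display facts, the LOWER half of C⁺ holds on the Scholz-minus half of R1** (kernel: `two_dvd_scriptL_of_partner_R1`). -/
theorem two_dvd_scriptL_onR1_of_partnerLaw (hP : PartnerLawR1) (hF : tyz_cmPointRingClassFrobeniusData) (h11 : thm11_parity_of_scriptL)
    (hGZK : rank_eq_analyticRank_of_analyticRank_le_one)
    (hl8 : l % 8 = 1) (hm8 : m % 8 = 5) (hlm : IsSquare ((l : ℤ) : ZMod m)) (hml : IsSquare ((m : ℤ) : ZMod l))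
    (hS : ScholzMinus l m)
    (hr1 : haveI := isElliptic_congruentNumberCurve (Nat.mul_ne_zero hlp.out.ne_zero hmp.out.ne_zero);
      (congruentNumberCurve (l * m)).analyticRank = 1)
    (h₂ : haveI := isElliptic_congruentNumberCurve (Nat.mul_ne_zero hlp.out.ne_zero hmp.out.ne_zero);
      Nat.card ((congruentNumberCurve (l * m)).selmerGroup 2) = 2 ^ 5) :
    ∀ L : ℤ, IsScriptL (l * m) L → (2 : ℤ) ∣ L := by
  haveI := isElliptic_congruentNumberCurve (Nat.mul_ne_zero hlp.out.ne_zero hmp.out.ne_zero)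
  have hA := (hP l m hl8 hm8 hlm hml hr1 h₂).mpr hS
  exact two_dvd_scriptL_of_partner_R1 hF h11 hGZK hl8 hm8 hlm hml hr1 h₂ hA

/-- **Granted F1-R2, the `#Sel₄ = 2⁶` hypothesis is a THEOREM on the no-half `l ≠ x² + 32y²` of R2** (with GZK; kernel: g20's T1 on R2). -/
theorem selmerFour_onR2_of_partnerLaw (hP : PartnerLawR2) (hGZK : rank_eq_analyticRank_of_analyticRank_le_one)
    (hl8 : l % 8 = 1) (hq8 : q % 8 = 7) (hlq : IsSquare ((l : ℤ) : ZMod q)) (hql : IsSquare ((q : ℤ) : ZMod l))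
    (hno : ¬ SumSq32 l)
    (hr1 : haveI := isElliptic_congruentNumberCurve (Nat.mul_ne_zero hlp.out.ne_zero hqp.out.ne_zero);
      (congruentNumberCurve (l * q)).analyticRank = 1)
    (h₂ : haveI := isElliptic_congruentNumberCurve (Nat.mul_ne_zero hlp.out.ne_zero hqp.out.ne_zero);
      Nat.card ((congruentNumberCurve (l * q)).selmerGroup 2) = 2 ^ 5) :
    haveI := isElliptic_congruentNumberCurve (Nat.mul_ne_zero hlp.out.ne_zero hqp.out.ne_zero)
    Nat.card ((congruentNumberCurve (l * q)).selmerGroup 4) = 2 ^ 6 := by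
  haveI := isElliptic_congruentNumberCurve (Nat.mul_ne_zero hlp.out.ne_zero hqp.out.ne_zero)
  have hA := (hP l q hl8 hq8 hlq hql hr1 h₂).mpr hno
  have hrank : (congruentNumberCurve (l * q)).mordellWeilRank = 1 := (hGZK _ hr1.le).1.trans hr1
  exact (rhoIndex_ne_one_and_selmerFour_of_partner_R2 hl8 hq8 hlq hql hrank h₂ hA).2.2

/-- **The two R2 conjectures give C⁺ (`stub_offTYZ_levelTwoScriptLExact`) on R2** — pure logic: the jump law turns `#Sel₄ = 2⁶` into `¬ R2Deep`,
the genus formula turns `¬ R2Deep` into `2 ∥ 𝓛`.  (The R1 twin is `Lines/offtyz_v7_LevelTwoR1Sketch.lean`.) -/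
theorem levelTwoScriptLExact_onR2_of (hJ : LevelTwoJumpLawR2) (hG : LevelTwoGenusFormulaR2)
    (hl8 : l % 8 = 1) (hq8 : q % 8 = 7) (hlq : IsSquare ((l : ℤ) : ZMod q)) (hql : IsSquare ((q : ℤ) : ZMod l))
    [(congruentNumberCurve (l * q)).IsElliptic]
    (hr : (congruentNumberCurve (l * q)).analyticRank = 1)
    (hS₂ : Nat.card ((congruentNumberCurve (l * q)).selmerGroup 2) = 2 ^ 5)
    (hS₄ : Nat.card ((congruentNumberCurve (l * q)).selmerGroup 4) = 2 ^ 6)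
    (L : ℤ) (hL : IsScriptL (l * q) L) : (2 : ℤ) ∣ L ∧ ¬ (4 : ℤ) ∣ L :=
  (hG l q hl8 hq8 hlq hql hr hS₂ L hL).mpr ((hJ l q hl8 hq8 hlq hql hS₂).mp hS₄)

/-- **Conversely the genus formula predicts `4 ∣ 𝓛(lq)` exactly on the deep members of R2 ∩ {r_an = 1}** (the B-locus of rank one:
Ш(E_{lq})[2^∞] ⊋ Ш[2]; census Ш_an = 16). -/
theorem four_dvd_scriptL_onR2_of (hG : LevelTwoGenusFormulaR2)
    (hl8 : l % 8 = 1) (hq8 : q % 8 = 7) (hlq : IsSquare ((l : ℤ) : ZMod q)) (hql : IsSquare ((q : ℤ) : ZMod l))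
    [(congruentNumberCurve (l * q)).IsElliptic]
    (hr : (congruentNumberCurve (l * q)).analyticRank = 1)
    (hS₂ : Nat.card ((congruentNumberCurve (l * q)).selmerGroup 2) = 2 ^ 5)
    (hdeep : R2Deep l q) (L : ℤ) (hL : IsScriptL (l * q) L) (h2 : (2 : ℤ) ∣ L) : (4 : ℤ) ∣ L := by
  by_contra h4
  exact ((hG l q hl8 hq8 hlq hql hr hS₂ L hL).mp ⟨h2, h4⟩) hdeep

end Compositions

end Summit.BirchSwinnertonDyer.PrintCf2.LevelTwo.OddSectors

end
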